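import Mathlib.LinearAlgebra.Isomorphisms
import Mathlib.LinearAlgebra.FreeModule.Basic
import Literature.NumberTheory.GaloisCohomology.PBasisKoszulIdentities
import HarnessLib

/-!
# The structure of the de Rham complex of a ring with a `p`-basis: `Zⁿ = Bⁿ ⊕ ⟨t_s^{p-1} dt_s⟩`, `Hⁿ` free

Let `R` be a ring of characteristic `p` with a finite `p`-basis `t : ι → R` (`ι` linearly ordered).  From the
Koszul contraction `h`, the Cartier projector `π` and the identities `dh + hd = 1 - π`, `πd = dπ = 0`, `π² = π`
(`PBasisKoszulOperators/Homotopy/Identities.lean`) we derive the classical structure theorem of the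
(Frobenius-twisted, i.e. `R`-linear through `c ↦ c^p`) de Rham complex `(Ωⁿ_R, d)`:

* the **Cartier vectors** `cartierVec n s = t_s^{p-1} • dt_s` (`s ⊆ ι` of size `n`; exponent vector
  `cartierExp s = (p-1)·𝟙_s`, characterised by `live = ∅`) are linearly independent and span the image of `π`
  (`range_πTwist`, basis `cartierVecBasis`);
* **`Zⁿ = Bⁿ ⊕ im π`**: `closedTwist_eq_exactTwist_sup_range_πTwist` and `disjoint_exactTwist_range_πTwist`
  (a closed form is `x = d (h x) + π x`; an exact form has `π x = 0`);
* **`Hⁿ = Zⁿ/Bⁿ ≅ im π` is FREE** on the classes `[t_s^{p-1} dt_s]` (`deRhamHEquivRangeπ`, `deRhamHBasis`,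
  `deRhamHBasis_apply`, `Module.Free R (deRhamH p R n)`).

The Cartier isomorphism proper (`invCartier p R n : Ωⁿ → Hⁿ` is bijective, `dt_s ↦ [t_s^{p-1} dt_s]`) is the
sequel `CartierIsomorphism.lean`.

## References

* L. Illusie, *Complexe de de Rham–Witt et cohomologie cristalline*, Ann. Sci. ÉNS 12 (1979), 0.(2.1.9)–0.2. [Illusie1979]
* N. Katz, *Nilpotent connections and the monodromy theorem*, Publ. IHÉS 39 (1970), Thm. 7.2. [folklore]
-/

noncomputable section

open scoped BigOperators
open KaehlerDifferential (D)
open Literature.AlgebraicGeometry.Crystalline.KaehlerExteriorDerivative (kaehlerExteriorDerivative)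

namespace Literature.NumberTheory.GaloisCohomology

universe u v

namespace IsPBasis

open DeRhamWeights

variable {p : ℕ} [hp : Fact p.Prime] {R : Type u} [CommRing R] [CharP R p] {ι : Type v} [Fintype ι]
  [LinearOrder ι] {t : ι → R}

/-! ### Cartier exponents and Cartier vectors -/

/-- The exponent `p - 1 : Fin p`. [folklore] -/
def predP : Fin p := ⟨p - 1, Nat.sub_lt hp.out.pos Nat.one_pos⟩

/-- `(predP : ℕ) = p - 1`. [folklore] -/
@[simp] theorem val_predP : ((predP : Fin p) : ℕ) = p - 1 := rfl

omit [Fintype ι] [LinearOrder ι] in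
/-- **The Cartier exponent vector** `(p-1)·𝟙_s` of a set `s` of indices: the exponent of `t_s^{p-1} dt_s`.
[cite: Illusie1979, 0.2] -/
def cartierExp [DecidableEq ι] (s : Finset ι) : ι → Fin p := fun i => if i ∈ s then predP else 0

omit [Fintype ι] in
/-- `cartierExp s i = p - 1` on `s`. [folklore] -/
theorem cartierExp_of_mem {s : Finset ι} {i : ι} (hi : i ∈ s) : cartierExp (p := p) s i = predP := by
  rw [cartierExp, if_pos hi]

omit [Fintype ι] in
/-- `cartierExp s i = 0` off `s`. [folklore] -/
theorem cartierExp_of_not_mem {s : Finset ι} {i : ι} (hi : i ∉ s) : cartierExp (p := p) s i = 0 := by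
  rw [cartierExp, if_neg hi]

/-- **No live index iff the exponent vector is the Cartier exponent**: `live α s = ∅ ↔ α = (p-1)·𝟙_s`.
[cite: Illusie1979, 0.2] -/
theorem live_eq_empty_iff_eq_cartierExp (α : ι → Fin p) (s : Finset ι) :
    live α s = ∅ ↔ α = cartierExp s := by
  rw [live_eq_empty_iff]
  constructor
  · intro H
    funext i
    by_cases hi : i ∈ s
    · rw [cartierExp_of_mem hi]
      exact Fin.ext ((H i).1 hi)
    · rw [cartierExp_of_not_mem hi]
      exact (H i).2 hi
  · rintro rfl i
    exact ⟨fun hi => by rw [cartierExp_of_mem hi, val_predP], fun hi => cartierExp_of_not_mem hi⟩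

/-- The Cartier exponent has no live index. [folklore] -/
theorem live_cartierExp (s : Finset ι) : live (cartierExp (p := p) s) s = ∅ :=
  (live_eq_empty_iff_eq_cartierExp _ s).2 rfl

variable (h : IsPBasis p t)

/-- **The Cartier vectors** `t_s^{p-1} • dt_s` (as twisted monomial basis vectors `E (cartierExp s, s)`).
[cite: Illusie1979, 0.2] -/
def cartierVec (n : ℕ) (s : Set.powersetCard ι n) : FrobeniusTwist p R (⋀[R]^n (Ω[R⁄ℤ])) :=
  h.twistFormBasis n (cartierExp (s : Finset ι), s)

/-- The Cartier vector is `of (t^{(p-1)𝟙_s} • dt_s)`. [folklore] -/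
theorem cartierVec_eq (n : ℕ) (s : Set.powersetCard ι n) :
    h.cartierVec n s = FrobeniusTwist.of p R (pMonomial p t (cartierExp (s : Finset ι)) • h.formBasis n s) :=
  h.twistFormBasis_apply n _ s

/-- **The matrix of `π`**: `π (E (α, s)) = E (α, s)` if `α` is the Cartier exponent of `s`, else `0`. [folklore] -/
theorem πVec_eq_ite (n : ℕ) (α : ι → Fin p) (s : Set.powersetCard ι n) :
    h.πVec n (α, s) = if α = cartierExp (s : Finset ι) then h.cartierVec n s else 0 := by
  by_cases hα : α = cartierExp (s : Finset ι)
  · rw [if_pos hα, h.πVec_of_live_eq_empty n ((live_eq_empty_iff_eq_cartierExp α _).2 hα), cartierVec, hα]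
  · rw [if_neg hα, h.πVec_of_live_nonempty n
      (Finset.nonempty_iff_ne_empty.2 fun h0 => hα ((live_eq_empty_iff_eq_cartierExp α _).1 h0))]

/-- `π` fixes the Cartier vectors. [folklore] -/
theorem πTwist_cartierVec (n : ℕ) (s : Set.powersetCard ι n) : h.πTwist n (h.cartierVec n s) = h.cartierVec n s := by
  rw [cartierVec, πTwist_basis, h.πVec_of_live_eq_empty n (live_cartierExp _)]

/-! ### `im π` is free on the Cartier vectors -/

/-- The Cartier vectors are linearly independent (a sub-family of the monomial basis). [folklore] -/
theorem linearIndependent_cartierVec (n : ℕ) : LinearIndependent R (h.cartierVec n) :=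
  (h.twistFormBasis n).linearIndependent.comp
    (fun s : Set.powersetCard ι n => (cartierExp (s : Finset ι), s)) fun _ _ hss' => (Prod.ext_iff.1 hss').2

/-- **`im π` is the span of the Cartier vectors.** [cite: Illusie1979, 0.2] -/
theorem range_πTwist (n : ℕ) :
    LinearMap.range (h.πTwist n) = Submodule.span R (Set.range (h.cartierVec n)) := by
  apply le_antisymm
  · rw [LinearMap.range_eq_map, ← (h.twistFormBasis n).span_eq, Submodule.map_span, Submodule.span_le]
    rintro _ ⟨_, ⟨⟨α, s⟩, rfl⟩, rfl⟩
    rw [SetLike.mem_coe, πTwist_basis, πVec_eq_ite]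
    split_ifs
    · exact Submodule.subset_span ⟨s, rfl⟩
    · exact Submodule.zero_mem _
  · rw [Submodule.span_le]
    rintro _ ⟨s, rfl⟩
    exact ⟨h.cartierVec n s, h.πTwist_cartierVec n s⟩

/-- **The basis of `im π` by the Cartier vectors.** [cite: Illusie1979, 0.2] -/
def cartierVecBasis (n : ℕ) : Module.Basis (Set.powersetCard ι n) R (LinearMap.range (h.πTwist n)) :=
  (Module.Basis.span (h.linearIndependent_cartierVec n)).map (LinearEquiv.ofEq _ _ (h.range_πTwist n).symm)

/-- The vectors of `cartierVecBasis` are the Cartier vectors. [folklore] -/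
@[simp] theorem coe_cartierVecBasis_apply (n : ℕ) (s : Set.powersetCard ι n) :
    (h.cartierVecBasis n s : FrobeniusTwist p R (⋀[R]^n (Ω[R⁄ℤ]))) = h.cartierVec n s := by
  rw [cartierVecBasis, Module.Basis.map_apply, Module.Basis.span_apply]
  rfl

/-- `im π` is a free `R`-module. [folklore] -/
theorem free_range_πTwist (n : ℕ) : Module.Free R (LinearMap.range (h.πTwist n)) :=
  Module.Free.of_basis (h.cartierVecBasis n)

/-! ### `Zⁿ = Bⁿ ⊕ im π` -/

/-- `im π ≤ Zⁿ`: the Cartier vectors are closed. [folklore] -/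
theorem range_πTwist_le_closedTwist (n : ℕ) : LinearMap.range (h.πTwist n) ≤ closedTwist p R n := by
  rintro _ ⟨x, rfl⟩
  rw [← ker_dTwist, LinearMap.mem_ker, h.dTwist_πTwist]

/-- **`π` kills exact forms.** [folklore] -/
theorem πTwist_eq_zero_of_mem_exactTwist (n : ℕ) {x : FrobeniusTwist p R (⋀[R]^n (Ω[R⁄ℤ]))}
    (hx : x ∈ exactTwist p R n) : h.πTwist n x = 0 := by
  cases n with
  | zero =>
    rw [mem_exactTwist_iff, exactForms_zero, AddSubgroup.mem_bot] at hx
    rw [show x = 0 from (FrobeniusTwist.of p R).symm.injective (by rw [hx, map_zero]), map_zero]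
  | succ m =>
    rw [← range_dTwist, LinearMap.mem_range] at hx
    obtain ⟨y, rfl⟩ := hx
    exact h.πTwist_dTwist m y

/-- **A closed form minus its Cartier projection is exact** (`x - π x = d (h x)` in positive degree, `= 0` in
degree `0`). [cite: Illusie1979, 0.2] -/
theorem sub_πTwist_mem_exactTwist (n : ℕ) {x : FrobeniusTwist p R (⋀[R]^n (Ω[R⁄ℤ]))}
    (hx : x ∈ closedTwist p R n) : x - h.πTwist n x ∈ exactTwist p R n := by
  rw [← ker_dTwist, LinearMap.mem_ker] at hx
  cases n with
  | zero =>
    rw [← h.hTwist_dTwist_zero, hx, map_zero]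
    exact Submodule.zero_mem _
  | succ m =>
    rw [← h.dTwist_hTwist_add_hTwist_dTwist, hx, map_zero, add_zero, ← range_dTwist]
    exact LinearMap.mem_range_self _ _

/-- **`Zⁿ = Bⁿ + im π`.** [cite: Illusie1979, 0.2] -/
theorem closedTwist_eq_exactTwist_sup_range_πTwist (n : ℕ) :
    closedTwist p R n = exactTwist p R n ⊔ LinearMap.range (h.πTwist n) := by
  apply le_antisymm
  · intro x hx
    rw [show x = (x - h.πTwist n x) + h.πTwist n x from (sub_add_cancel _ _).symm]
    exact Submodule.add_mem_sup (h.sub_πTwist_mem_exactTwist n hx) (LinearMap.mem_range_self _ _)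
  · exact sup_le (exactTwist_le_closedTwist p R n) (h.range_πTwist_le_closedTwist n)

/-- **`Bⁿ ∩ im π = 0`.** [cite: Illusie1979, 0.2] -/
theorem disjoint_exactTwist_range_πTwist (n : ℕ) :
    Disjoint (exactTwist p R n) (LinearMap.range (h.πTwist n)) := by
  rw [Submodule.disjoint_def]
  rintro x hx ⟨y, rfl⟩
  rw [← h.πTwist_πTwist, h.πTwist_eq_zero_of_mem_exactTwist n hx]

/-- A form in `im π` that is exact vanishes. [folklore] -/
theorem eq_zero_of_mem_exactTwist_of_mem_range (n : ℕ) {x : FrobeniusTwist p R (⋀[R]^n (Ω[R⁄ℤ]))}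
    (hx : x ∈ exactTwist p R n) (hx' : x ∈ LinearMap.range (h.πTwist n)) : x = 0 :=
  (Submodule.disjoint_def.1 (h.disjoint_exactTwist_range_πTwist n)) x hx hx'

/-! ### `Hⁿ ≅ im π` is free on the classes of the Cartier vectors -/

/-- `π` restricted to closed forms, with values in `im π`. [folklore] -/
def πRestrict (n : ℕ) : closedTwist p R n →ₗ[R] LinearMap.range (h.πTwist n) :=
  (h.πTwist n).rangeRestrict ∘ₗ (closedTwist p R n).subtype

/-- `πRestrict` underlying value. [folklore] -/
@[simp] theorem coe_πRestrict_apply (n : ℕ) (x : closedTwist p R n) :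
    (h.πRestrict n x : FrobeniusTwist p R (⋀[R]^n (Ω[R⁄ℤ]))) = h.πTwist n x :=
  rfl

/-- `πRestrict` is onto `im π` (`π` is idempotent and its image is closed). [folklore] -/
theorem πRestrict_surjective (n : ℕ) : Function.Surjective (h.πRestrict n) := by
  rintro ⟨_, x, rfl⟩
  refine ⟨⟨h.πTwist n x, h.range_πTwist_le_closedTwist n (LinearMap.mem_range_self _ _)⟩, Subtype.ext ?_⟩
  rw [coe_πRestrict_apply]
  exact h.πTwist_πTwist n x

/-- The kernel of `πRestrict` is `Bⁿ` (inside `Zⁿ`): this is `Zⁿ = Bⁿ ⊕ im π`. [folklore] -/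
theorem ker_πRestrict (n : ℕ) :
    LinearMap.ker (h.πRestrict n) = (exactTwist p R n).comap (closedTwist p R n).subtype := by
  ext ⟨x, hx⟩
  rw [LinearMap.mem_ker, Submodule.mem_comap, Submodule.subtype_apply, Subtype.ext_iff, coe_πRestrict_apply]
  change h.πTwist n x = 0 ↔ x ∈ exactTwist p R n
  constructor
  · intro h0
    have := h.sub_πTwist_mem_exactTwist n hx
    rwa [h0, sub_zero] at this
  · exact h.πTwist_eq_zero_of_mem_exactTwist n

/-- **`Hⁿ = Zⁿ/Bⁿ ≅ im π`**, `[x] ↦ π x`. [cite: Illusie1979, 0.2] -/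
def deRhamHEquivRangeπ (n : ℕ) : deRhamH p R n ≃ₗ[R] LinearMap.range (h.πTwist n) :=
  (Submodule.quotEquivOfEq _ _ (h.ker_πRestrict n).symm).trans
    (LinearMap.quotKerEquivOfSurjective (h.πRestrict n) (h.πRestrict_surjective n))

/-- `deRhamHEquivRangeπ [ω] = π ω`. [folklore] -/
theorem coe_deRhamHEquivRangeπ_cls (n : ℕ) (ω : ⋀[R]^n (Ω[R⁄ℤ]))
    (hω : kaehlerExteriorDerivative ℤ R n ω = 0) :
    (h.deRhamHEquivRangeπ n (deRhamH.cls ω hω) : FrobeniusTwist p R (⋀[R]^n (Ω[R⁄ℤ]))) =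
      h.πTwist n (FrobeniusTwist.of p R ω) := by
  change ((LinearMap.quotKerEquivOfSurjective (h.πRestrict n) (h.πRestrict_surjective n)
      (Submodule.quotEquivOfEq _ _ (h.ker_πRestrict n).symm
        (Submodule.Quotient.mk ⟨FrobeniusTwist.of p R ω, hω⟩)) : LinearMap.range (h.πTwist n)) :
      FrobeniusTwist p R (⋀[R]^n (Ω[R⁄ℤ]))) = _
  rw [Submodule.quotEquivOfEq_mk, LinearMap.quotKerEquivOfSurjective_apply_mk, coe_πRestrict_apply]

/-- The inverse: `deRhamHEquivRangeπ.symm` of a Cartier vector is the class of `t_s^{p-1} dt_s`. [folklore] -/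
theorem deRhamHEquivRangeπ_symm_cartierVecBasis (n : ℕ) (s : Set.powersetCard ι n) :
    (h.deRhamHEquivRangeπ n).symm (h.cartierVecBasis n s) =
      deRhamH.cls (pMonomial p t (cartierExp (s : Finset ι)) • h.formBasis n s)
        (by
          have hz := h.range_πTwist_le_closedTwist n (h.cartierVecBasis n s).2
          rwa [coe_cartierVecBasis_apply, cartierVec_eq, mem_closedTwist_iff] at hz) := by
  apply (h.deRhamHEquivRangeπ n).injective
  rw [LinearEquiv.apply_symm_apply]
  apply Subtype.ext
  rw [coe_deRhamHEquivRangeπ_cls, coe_cartierVecBasis_apply, ← cartierVec_eq, πTwist_cartierVec]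

/-- **The basis of `Hⁿ` by the classes `[t_s^{p-1} dt_s]`** (`s ⊆ ι` of size `n`). [cite: Illusie1979, 0.(2.1.9)] -/
def deRhamHBasis (n : ℕ) : Module.Basis (Set.powersetCard ι n) R (deRhamH p R n) :=
  (h.cartierVecBasis n).map (h.deRhamHEquivRangeπ n).symm

/-- The vectors of `deRhamHBasis` are the classes `[t_s^{p-1} dt_s]`. [folklore] -/
theorem deRhamHBasis_apply (n : ℕ) (s : Set.powersetCard ι n) :
    h.deRhamHBasis n s = deRhamH.cls (pMonomial p t (cartierExp (s : Finset ι)) • h.formBasis n s)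
      (by
        have hz := h.range_πTwist_le_closedTwist n (h.cartierVecBasis n s).2
        rwa [coe_cartierVecBasis_apply, cartierVec_eq, mem_closedTwist_iff] at hz) := by
  rw [deRhamHBasis, Module.Basis.map_apply, deRhamHEquivRangeπ_symm_cartierVecBasis]

include h in
/-- **`Hⁿ_dR(R) = Zⁿ/Bⁿ` is a free `R`-module (through Frobenius)** of rank `(#ι choose n)`, for a ring with a
finite `p`-basis. [cite: Illusie1979, 0.(2.1.9)] -/
theorem free_deRhamH (n : ℕ) : Module.Free R (deRhamH p R n) :=
  Module.Free.of_basis (h.deRhamHBasis n)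

end IsPBasis

end Literature.NumberTheory.GaloisCohomology

end
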